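import Summits.Ventures.PercRepro2.CaseOneJ1
import Summits.Ventures.PercRepro2.CaseOneStarMainI

/-!
# `(J1)` for the marked star (blind cell PercRepro2, p1 g19; CONJECTURES row 2′J1)

The marked-star predicate is symmetric under the root swap (`IsMarkedStarAt.swap`), so the `(J1₁)`
theorem `jOneOne_of_markedStar` (CaseOneStarMainI) and its mirror add up to **`jOne_of_markedStar`**
(`jOne_of_jOneOne_of_mirror`): `(J1)` for `a₃` adjacent exactly to `a₁, a₂, o, b`, every finite
graph, every weight vector. Own code; standard axioms.
-/

namespace Summit.Ventures.PercRepro2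

namespace CaseOne

section Swap
variable {V : Type*} {E : Type*}
variable {ends : E → Sym2 V} {o a₁ a₂ b a₃ : V} {e₁ e₂ eo eb : E}

/-- The marked star with the roots swapped. -/
theorem IsMarkedStarAt.swap (h : IsMarkedStarAt ends o a₁ a₂ b a₃ e₁ e₂ eo eb) :
    IsMarkedStarAt ends o a₂ a₁ b a₃ e₂ e₁ eo eb where
  ends_1 := h.ends_2
  ends_2 := h.ends_1
  ends_o := h.ends_o
  ends_b := h.ends_b
  ne_12 := h.ne_12.symm
  ne_1o := h.ne_2o
  ne_1b := h.ne_2b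
  ne_2o := h.ne_1o
  ne_2b := h.ne_1b
  ne_ob := h.ne_ob
  unique := fun e he => by
    rcases h.unique e he with h' | h' | h' | h'
    · exact Or.inr (Or.inl h')
    · exact Or.inl h'
    · exact Or.inr (Or.inr (Or.inl h'))
    · exact Or.inr (Or.inr (Or.inr h'))
  ne_a1 := h.ne_a2
  ne_a2 := h.ne_a1
  ne_o := h.ne_o
  ne_b := h.ne_b

end Swap

section JOne
variable {V : Type*} {E : Type*} [Fintype E] [DecidableEq E] [Fintype V] [DecidableEq V]
  {R : Type*} [Field R] [LinearOrder R] [IsStrictOrderedRing R]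
variable {ends : E → Sym2 V} {o a₁ a₂ b a₃ : V} {e₁ e₂ eo eb : E}

/-- **`(J1)` for the marked star**: `a₃` adjacent exactly to `a₁, a₂, o, b`. -/
theorem jOne_of_markedStar (p : E → R) (hp : IsProbVec p)
    (h : IsMarkedStarAt ends o a₁ a₂ b a₃ e₁ e₂ eo eb) : JOne p ends o a₁ a₂ a₃ b :=
  jOne_of_jOneOne_of_mirror p ends o a₁ a₂ a₃ b (jOneOne_of_markedStar p hp h)
    (jOneOne_of_markedStar p hp h.swap)

end JOne

end CaseOne

end Summit.Ventures.PercRepro2
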